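import Summits.QuantumFields.QCD.Theses.QuarksAsStableAction
import Summits.QuantumFields.QCD.Theses.WilsonQuarkChessboard

/-!
# Sketch — crux idea `free-tangent-landau-chessboard` (crux stmt-QuantumFields-9736,
`QuarksAsStableAction.WilsonQuarkStability`), ideator 1, round 1.

First lemma(s) of the line, stated over existing declarations only (`wilsonDirac`,
`fermionDet`, `unitaryFundamentalRep`, `GaugeConfig`, `gaugeTransform`, `plaquetteHolonomy`,
`Site.shift`), plus the typed transfer target.  Nothing is proved here except two `rfl`-level
sanity checks; every `def … : Prop` below is a STATEMENT.

Line: log|det| is concave on positive-definite matrices, so its tangent plane at the FREE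
antiperiodic operator bounds the quark excess by an explicit local gauge-variant functional `Φ`;
minimising over gauges gives the lattice Landau-gauge functional (`FreeTangentLandauBound`);
the quark chessboard (route WilsonQuarkChessboard, crux `QuarkChessboard`, stmt-9306) localises
to period-2 reflection tilings, on which Landau ≍ Wilson by gauge fixing on the hypercube graph
Q₄ (`CellLandauLeWilson`), giving `TilingStability` and hence the crux at even `L`.
-/

namespace Summit.QuantumFields.QCD.Cruxes.WilsonQuarkStability.Ideator1

open scoped BigOperators Matrix ComplexConjugate
open Classical
open Literature.MathematicalPhysics.QuantumFieldTheory Literature.MathematicalPhysics.QuantumLattice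

noncomputable section

/-- Colour groups. -/
abbrev SU3 : Type := Matrix.specialUnitaryGroup (Fin 3) ℂ
abbrev U3 : Type := Matrix.unitaryGroup (Fin 3) ℂ

/-- The fundamental representation of `U(3)` used by the crux's inlined operator. -/
abbrev ρ₃ : U3 →* Matrix (Fin 3) (Fin 3) ℂ := unitaryFundamentalRep (Fin 3) ℂ

variable {L : ℕ}

/-- Lift of an `SU(3)` field to `U(3)` (exactly the subterm the crux decl inlines). -/
def liftU3 (U : GaugeConfig 4 L SU3) : GaugeConfig 4 L U3 :=
  fun e => ⟨(U e).1, Matrix.specialUnitaryGroup_le_unitaryGroup (U e).2⟩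

/-- All-axes antiperiodic twist: links leaving the slice `x_μ = -1` are multiplied by `-1 ∈ U(3)`
(the crux's seam convention; route WilsonQuarkChessboard writes the same test as
`(e.1 e.2).val + 1 = L`). -/
def apTwist (V : GaugeConfig 4 L U3) : GaugeConfig 4 L U3 :=
  fun e => if e.1 e.2 = -1 then -V e else V e

/-- The `r = 1` Wilson–Dirac operator with antiperiodic quarks in all four directions. -/
def apDirac [NeZero L] (V : GaugeConfig 4 L U3) (m : ℝ) :
    Matrix (Literature.Probability.LatticeModels.TorusSite 4 L × Fin 3 × Fin 4)
      (Literature.Probability.LatticeModels.TorusSite 4 L × Fin 3 × Fin 4) ℂ :=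
  wilsonDirac ρ₃ (apTwist V) m 1

/-- Its determinant `det D_AP[V, m]`. -/
def apDet [NeZero L] (V : GaugeConfig 4 L U3) (m : ℝ) : ℂ := fermionDet (apDirac V m)

/-- Sanity (`rfl`): on `SU(3)` fields `apDet (liftU3 U) m` is literally the crux's inlined `apDet U m`. -/
example [NeZero L] (U : GaugeConfig 4 L SU3) (m : ℝ) :
    apDet (liftU3 U) m =
      fermionDet (wilsonDirac (unitaryFundamentalRep (Fin 3) ℂ)
        (fun e => if e.1 e.2 = -1 then
            -(⟨(U e).1, Matrix.specialUnitaryGroup_le_unitaryGroup (U e).2⟩ : Matrix.unitaryGroup (Fin 3) ℂ)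
          else ⟨(U e).1, Matrix.specialUnitaryGroup_le_unitaryGroup (U e).2⟩) m 1) := rfl

/-- `H_V := D_AP[V,m]ᴴ · D_AP[V,m]` (positive semidefinite; positive definite for the free field
`V = 1` and `|m| < 2`, all `L`: the free all-axes-antiperiodic symbol never vanishes). -/
def gram [NeZero L] (V : GaugeConfig 4 L U3) (m : ℝ) :
    Matrix (Literature.Probability.LatticeModels.TorusSite 4 L × Fin 3 × Fin 4)
      (Literature.Probability.LatticeModels.TorusSite 4 L × Fin 3 × Fin 4) ℂ :=
  (apDirac V m)ᴴ * apDirac V m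

/-- **The free-tangent functional** `Φ(V, m) := Re Tr(H_1⁻¹ H_V) − 12 L⁴` — the value at `H_V` of
the tangent plane of the concave function `log det` at the FREE antiperiodic Gram matrix `H_1`,
minus `log det H_1`.  It is LOCAL (range 2: its coefficients are the free antiperiodic
propagator `H_1⁻¹(x,y)`, `|x − y| ≤ 2`) and gauge-VARIANT. -/
def freeTangent [NeZero L] (V : GaugeConfig 4 L U3) (m : ℝ) : ℝ :=
  ((gram 1 m)⁻¹ * gram V m).trace.re - 12 * (L : ℝ) ^ 4

/-- **Lattice Landau-gauge functional in the gauge `g`**: `Σ_links (3 − Re tr V^g_ℓ) = ½ Σ ‖V^g_ℓ − 1‖_F²`. -/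
def landauFunctional [NeZero L] (V : GaugeConfig 4 L U3) (g : Site 4 L → U3) : ℝ :=
  ∑ e : Edge 4 L, (3 - (ρ₃ (gaugeTransform g V e)).trace.re)

/-- Plaquette deficit `3 − Re tr V_p` of a `U(3)` field. -/
def deficit (V : GaugeConfig 4 L U3) (p : Plaquette 4 L) : ℝ :=
  3 - (ρ₃ (plaquetteHolonomy V p.1 p.2.1.1 p.2.1.2)).trace.re

/-! ## Step A — the tangent inequality and the first lemma -/

/-- **A0 (support, provable now; pure linear algebra).** For every `U(3)` field `V`, every `L`
and `|m| < 2`: `|det D_AP[V,m]|² ≤ exp(Φ(V,m)) · |det D_AP[1,m]|²`.  Proof: `H_1 ≻ 0`; with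
`M := H_1^{-1/2} H_V H_1^{-1/2} ⪰ 0`, `log det M = Σ log μ_i ≤ Σ (μ_i − 1) = Tr(H_1⁻¹H_V) − N`
(when some `μ_i = 0` the left side is `det = 0`).  This is `det(1+K) ≤ e^{Tr K}` for `1 + K ⪰ 0`. -/
def FreeTangentInequality : Prop :=
  ∀ (L : ℕ) [NeZero L] (m : ℝ), |m| < 2 → ∀ V : GaugeConfig 4 L U3,
    ‖apDet V m‖ ^ 2 ≤ Real.exp (freeTangent V m) * ‖apDet (1 : GaugeConfig 4 L U3) m‖ ^ 2

/-- **A1 (support, provable now).** The tangent functional is globally quadratic in the link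
defects, uniformly in the volume: `Φ(V,m) ≤ C · Σ_ℓ (3 − Re tr V_ℓ)`.  Why: `Φ = Σ_x φ_x` with
`φ_x` a fixed polynomial in the links within distance 2 of `x` whose coefficients are entries of the
free AP propagator at separation ≤ 2 — bounded uniformly in `L ≥ L₀` and `|m| ≤ ε` because
`L⁻⁴ Σ_{k ∈ AP grid} |D̃_m(k)|⁻² ≤ C ∫ d⁴k/|k|² < ∞` in `d = 4`; the LINEAR part of `Φ` at
`V = 1` is the free current expectation, which vanishes on the `k ↔ −k`-symmetric antiperiodic
grid, so the global remainder is `−½ Re tr[a_ℓ (1 − V_ℓ)ᴴ(1 − V_ℓ)]`-type, i.e. `≤ C ‖V_ℓ − 1‖²`. -/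
def TangentQuadraticBound : Prop :=
  ∃ ε C : ℝ, 0 < ε ∧ ∃ L₀ : ℕ, ∀ (L : ℕ) [NeZero L], L₀ ≤ L → ∀ m : ℝ, |m| ≤ ε →
    ∀ V : GaugeConfig 4 L U3, freeTangent V m ≤ C * landauFunctional V (fun _ => 1)

/-- **FIRST LEMMA (Theorem A): the free-tangent / Landau-gauge stability bound.**  For every
gauge `g`, `|det D_AP[U,m]| ≤ exp(C · Σ_ℓ (3 − Re tr U^g_ℓ)) · |det D_AP[1,m]|`, uniformly in
`L ≥ L₀` and `|m| ≤ ε`; i.e. the quark excess is bounded by `C ×` the minimal lattice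
Landau-gauge functional.  (A0 ∧ A1 ∧ gauge invariance of `det`, the twist being central.)
Valid for ALL `L` (odd included) and all fields; it is the crux with `S_W` replaced by the Landau
functional — sharp for fields that are globally near a pure gauge, lossy in the infrared. -/
def FreeTangentLandauBound : Prop :=
  ∃ ε C : ℝ, 0 < ε ∧ ∃ L₀ : ℕ, ∀ (L : ℕ) [NeZero L], L₀ ≤ L → ∀ m : ℝ, |m| ≤ ε →
    ∀ (U : GaugeConfig 4 L SU3) (g : Site 4 L → U3),
      ‖apDet (liftU3 U) m‖ ≤ Real.exp (C * landauFunctional (liftU3 U) g) * ‖apDet (1 : GaugeConfig 4 L U3) m‖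

/-! ## Step B — on one closed hypercube, Landau ≍ Wilson (finite combinatorics on Q₄) -/

/-- Links of the closed unit hypercube with lowest corner `c` (32 of them when `L ≥ 3`). -/
def cellEdges [NeZero L] (c : Site 4 L) : Finset (Edge 4 L) :=
  Finset.univ.filter fun e => (∀ ν, (e.1 ν - c ν).val ≤ 1) ∧ (e.1 e.2 - c e.2).val = 0

/-- Plaquettes of the closed unit hypercube with lowest corner `c` (24 of them when `L ≥ 3`). -/
def cellPlaquettes [NeZero L] (c : Site 4 L) : Finset (Plaquette 4 L) :=
  Finset.univ.filter fun p =>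
    (∀ ν, (p.1 ν - c ν).val ≤ 1) ∧ (p.1 p.2.1.1 - c p.2.1.1).val = 0 ∧ (p.1 p.2.1.2 - c p.2.1.2).val = 0

/-- **B (support, provable now): cell gauge fixing.**  Tree gauge on a spanning tree of the
hypercube graph `Q₄` plus the telescoping bound `‖Π Wᵢ − 1‖ ≤ Σ ‖Wᵢ − 1‖` for unitaries (every
non-tree link's defect is a product of ≤ c₄ cell plaquettes, since 4-cycles span the cycle space
of `Q₄`): some gauge makes the 32 link defects of a cell at most `C_Q ×` its 24 plaquette deficits.
No smallness assumption. -/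
def CellLandauLeWilson : Prop :=
  ∃ C : ℝ, ∀ (L : ℕ) [NeZero L], 4 ≤ L → ∀ (V : GaugeConfig 4 L U3) (c : Site 4 L),
    ∃ g : Site 4 L → U3,
      (∑ e ∈ cellEdges c, (3 - (ρ₃ (gaugeTransform g V e)).trace.re)) ≤
        C * ∑ p ∈ cellPlaquettes c, deficit V p

/-! ## Step C — the transfer target: stability of period-2 reflection tilings -/

/-- The period-2 site-reflection tiling of the torus by the closed unit cell with lowest corner
`c` — VERBATIM the `tile` of `WilsonQuarkChessboard.QuarkChessboard` (stmt-9306). -/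
def tile (c : Site 4 L) (V : GaugeConfig 4 L U3) : GaugeConfig 4 L U3 :=
  fun e => if (e.1 e.2 - c e.2).val % 2 = 0
    then V (fun ν => c ν + (((e.1 ν - c ν).val % 2 : ℕ) : ZMod L), e.2)
    else (V (fun ν => c ν + (((Site.shift e.1 e.2 ν - c ν).val % 2 : ℕ) : ZMod L), e.2))⁻¹

/-- **C⁺ = TilingStability (the transferred crux).**  For every cell `c` of every `U(3)` field on
an even torus, the tiling's determinant exceeds the free antiperiodic one by at most
`exp(C · L⁴ · s_c(V))`, `s_c` = sum of the cell's 24 plaquette deficits (`= 4 S_W(tile c V)/L⁴`).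
WHY EASIER than the crux: (i) A + B prove it outright — in the fold-extended cell gauge the
tiling's Landau functional is `(L⁴/8)·Σ_cell ‖u^g − 1‖² ≤ C L⁴ s_c`, no infrared loss because the
best gauge is cell-local; (ii) independently, Bloch reduction makes `L` enter only through a
Riemann sum over `(L/2)⁴` momenta of `log|det|` of `192 × 192` blocks; (iii) no sign of any Hessian
is needed (contrast `FlatCellOptimal`, `CriticalLineDiamagnetism`). -/
def TilingStability : Prop :=
  ∃ ε C : ℝ, 0 < ε ∧ ∃ L₀ : ℕ, ∀ (L : ℕ) [NeZero L], Even L → L₀ ≤ L → ∀ m : ℝ, |m| ≤ ε →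
    ∀ (V : GaugeConfig 4 L U3) (c : Site 4 L),
      ‖apDet (tile c V) m‖ ≤ Real.exp (C * (L : ℝ) ^ 4 * ∑ p ∈ cellPlaquettes c, deficit V p) * ‖apDet (1 : GaugeConfig 4 L U3) m‖

/-- The crux restricted to even tori (what chessboard localisation delivers directly; the route's
bridge `StableActionBridge` consumes the AP-even family). -/
def WilsonQuarkStabilityEven : Prop :=
  ∃ ε δ K c₂ C : ℝ, 0 < ε ∧ 0 < δ ∧ ∃ L₀ : ℕ, ∀ (L : ℕ) [NeZero L], Even L → L₀ ≤ L →
    ∀ m : ℝ, |m| ≤ ε → ∀ U : GaugeConfig 4 L SU3,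
      ‖apDet (liftU3 U) m‖ ≤
        Real.exp (K + c₂ * (∑ p ∈ Finset.univ.filter (fun p => deficit (liftU3 U) p < δ), deficit (liftU3 U) p)
          + C * ((Finset.univ.filter (fun p => δ ≤ deficit (liftU3 U) p)).card : ℝ)) * ‖apDet (1 : GaugeConfig 4 L U3) m‖

/-- **Transfer, even volumes**: tiling stability + the quark chessboard (stmt-9306, as typed in
route WilsonQuarkChessboard, specialised to `N = 3`) give the crux on even tori with `K = 0`,
`δ` arbitrary, `c₂ = C' := 4C`, `C = 4.5·C'` (each plaquette lies in 4 closed cells; deficits ≤ 4.5). -/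
def TransferEven : Prop :=
  TilingStability → Summit.QuantumFields.QCD.Theses.WilsonQuarkChessboard.QuarkChessboard →
    WilsonQuarkStabilityEven

/-- **Odd volumes (the remaining step, Schatten–Hölder device)**: from even-`L` stability on the
anisotropic even tori produced by merging one slab per odd direction, to the crux as typed.  Stated
here only as the implication to be skeletonised by crux-plan. -/
def OddFromEven : Prop :=
  WilsonQuarkStabilityEven → Summit.QuantumFields.QCD.Theses.QuarksAsStableAction.WilsonQuarkStability

end

end Summit.QuantumFields.QCD.Cruxes.WilsonQuarkStability.Ideator1
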